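import Summits.QuantumFields.YangMills.Theorems.BalabanUVNodesN11ChiPrimeAllSmallClassMeasure
import Literature.MathematicalPhysics.QuantumFieldTheory.Balaban1983to89.B14SeparationOfRecord

/-!
# DAG node N11 — LOCATED-FP IN NUMBERS AT EVERY STEP `k < K`: the block∕cube geometry of the pinned (3.3) data at level `k` (a level-`k` bond inside a block `B^k(y)` is read by
# the `L²M₂R_{k+1}`-cube of the block's centre), hence g32 E's transport bound, g33 F's graph-mass bound and F's measure bound for the (3.3)-ALL-SMALL CLASS hold with ONE
# BLOCK COMB PER BLOCK at every level: exponent `|Y|·(L^d − 1)`, `Y ⊆ T^{(k+1)}` (count-neutral helper, K1⁹ `--supports stmt-QuantumFields-27364`)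

HEADER — WORK-UNIT METADATA.  Cell `pub-ymgap`, YM-PLAN Track A (HUMAN RULING D-0062), seat `pub-ymgap-dag-n11-e` (g33; N11 [B14], s3 lineage = the averaging side of def-T's
one-step transport (†)), route `BalabanUVNodes`, item K1⁹ = stmt-QuantumFields-27364 (`--kind proof --supports 27364 --as helper`, count-neutral).  [III] = [Balaban1988Convergent],
[I] = [Balaban1987RG1].  Over this seat's g33 F `…N11ChiPrimeAllSmallClassMeasure` (★★★ `abs_integral_chiPrime_mul_graph_le`, ★★★ `measure_smallApproxFluct_graph_le_pow`, ★
`measurable_chiPrime_sect3DataOfRecord`), g32 E `…ChiPrimeFineOrbitAverageBoundTransport` (★★★ `abs_transportOfRecord_chiPrime_mul_le_ae`, level-generic with the geometry row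
`hcb` displayed; its `mem_bondsStar_sect3DataOfRecord_of_blockOf_eq` discharges `hcb` at `k = 0` only), g28 `…TransportBlockCombGauge` ∕ `…BlockCombCard` (block-comb forests,
`|T_Y| = |Y|·(L^d − 1)`), def-T's `StepWeightsOfRecord.sect3DataOfRecord` (`(□′^{∼2})^{(k)*}` = the level-`k` bonds `b` with `embIter k b₊, embIter k b₋ ∈ □′^{∼2}`), dag-n11-d's
`CubeRoughSection` (`abs_val_emb_blockOf_sub_le`, `mem_cubeEnl_of_val_near_cover`), `TorusGeometry.Site.val_emb`.

WHY THIS FILE.  E §2 and F §1 are level-generic, but the row «every comb bond is read by a (3.3) cube of `X`» was discharged at the record only at the first step (E §4, F §3: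
`k = 0`, where `embIter 0 = id`).  dag-n11-d's descendants chain (`…TopPairDescendantsDead`, `…DensityWithoutAllSmallTerm`) runs through EVERY level `1 ≤ k ≤ K`, and def-T's
(†) is the same at every step; so the located divergence (g31 LOCATED-FP: (†) reads (3.3)'s `χ′_k` through its UNIFORM fine-gauge orbit average) should carry its number at
every step.  §1 supplies the level-`k` geometry: labels of `embIter k x` and `embIter k x′` differ by at most `w·L^k` when those of `x, x′` differ by at most `w`
(`abs_val_embIter_sub_le`, induction on `k` via `Site.val_emb`), so a level-`k` site and its block centre land within `L·L^k` fine labels (`abs_val_embIter_emb_blockOf_sub_le`), and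
a bond inside `B^k(y)` lies in `(□′^{∼2})^{(k)*}` for the `L²M₂R_{k+1}`-cube `□′` of `embIter k (emb y)` once `L·L^k ≤ 2·side` (`mem_bondsStar_sect3DataOfRecord_of_blockOf_eq_level`);
both numeric side conditions follow from `0 < M₂` (`sideχ_level_guards`: `side = L^{k+2}·M₂·R_{k+1}`, `R_{k+1} ≥ 1` = `B14SeparationOfRecord.one_le_RkOfRecord`).  §2 then states, at every `k < K` and every `Y ⊆ T^{(k+1)}`
whose centres' cubes lie in `X`: E's a.e. transport bound, F's graph-mass bound and F's measure bound with exponent `|Y|·(L^d − 1)`; §3 re-reads F §3's `k = 0` measure bound on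
the set in dag-n11-d's own phrasing `{U | χ′_0(ALL)(U, ŪU) ≠ 0}` (H `…TopPairStepWeightDeadOnGraph`, p682217).

WHAT THIS FILE PROVES (0 `def`, 0 `sorry`, standard axioms).  §1 `abs_val_embIter_sub_le` · `abs_val_embIter_emb_blockOf_sub_le` · `sideχ_level_guards` (this seat's `B14SeparationOfRecord.one_le_RkOfRecord`) ·
★ `mem_bondsStar_sect3DataOfRecord_of_blockOf_eq_level`.  §2 (record, every `k < K`, generic `N`) ★★★ `abs_transportOfRecord_chiPrime_mul_le_ae_blockCombs_level` · ★★★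
`abs_integral_chiPrime_mul_graph_le_blockCombs_level` · ★★★ `measure_allSmall33_graph_le_pow_blockCombs_level` (+ `…_of_M₂_pos` guard editions) · ★★ `…_level_su2`.  §3 ★★
`measure_chiPrime_graph_ne_zero_le_pow_blockCombs` (`k = 0`, dag-n11-d's phrasing).

HONEST FRAMING.  [folklore] torus bookkeeping + measure theory composed BY NAME with def-T's ∕ r11's ∕ K0c's typed objects; UPPER BOUNDS on quantities of def-T's typed (†) and on
the product Haar measure of typed events — nothing of Bałaban's ESTIMATES asserted, no identity of print asserted or refuted; no set shown null, no lower bound claimed; (O3′) ∕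
Thm 1 ∕ Thm 2 NOT touched; N11 NOT discharged; K1⁹ NOT closed; counts unmoved (typed 28∕28 · discharged 6∕27 · A 6∕28); one finite-`𝕋⁴` programme at fixed `ε` — NOT `ℝ⁴`,
NOT OS, NOT a mass gap, NOT Clay.  No `sorry`, `axiom`, `def`, `instance`, `notation`.  Sources (SHAPE only): [III] (3.1) p.264, (3.2)–(3.4) p.265 with L.8–12, (2.5) p.255,
(2.16)–(2.17) p.257, (3.25) p.270; [I] (0.1)–(0.3) pp.251–252, (0.13)–(0.16) pp.254–255; [Balaban1985Averaging] (10) p.19.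
-/

noncomputable section
open MeasureTheory Function
open scoped ENNReal BigOperators
namespace Summit.QuantumFields.YangMills.Theorems.BalabanUVNodesN11ChiPrimeAllSmallClassMeasureLevel

open Literature.MathematicalPhysics.QuantumFieldTheory.Balaban1983to89
open GaugeField (gaugeAct)
open T4AxialGaugeFixing (TreeOrder combBonds)
open B12FaddeevPopov016 (FineGauge FineGaugeInvariant FPIdx fineTransf)
open B14.Sect3Decomp (Sect3Data chiPrime Vbox SmallApproxFluct chiPrime_eq_one_iff)
open B15DeterminingSets (embIter)
open B15Eq112TorusCover (cover lift cover_lift)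
open B15Claim189CubePin (cubeOfSite cubeOfSite_mem_cubeIndices mem_cubeExt_cubeIdx_of_near)
open T4Continuum Node00
open BalabanUVNodesN11TransportBlockCombGauge (blockOf_ends_of_mem_blockComb exists_treeOrder_blockCombs_avoiding_emb)
open BalabanUVNodesN11BlockCombCard (card_blockCombs)
open BalabanUVNodesN11ChiPrimeFineOrbitAverageBound (chiPrime_nonneg chiPrime_le_one)
open BalabanUVNodesN11ChiPrimeFineOrbitAverageBoundTransport (abs_transportOfRecord_chiPrime_mul_le_ae toReal_haar_dist1_lt_le_su2)
open BalabanUVNodesN11ChiPrimeAllSmallClassMeasure (abs_integral_chiPrime_mul_graph_le measure_smallApproxFluct_graph_le_pow measurable_chiPrime_sect3DataOfRecord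
  measure_allSmall33_graph_le_pow_blockCombs)

/-! ## §1  Level-`k` torus bookkeeping: block sites vs. block centres under `embIter k`, and the (3.3) cube of a block at the record -/

section Geometry

variable {P : Params}

/-- **`embIter k` STRETCHES LABEL DISTANCES BY AT MOST `L^k`**: if the residue labels of two level-`k` sites differ by at most `w` in every direction, those of their level-`0`
representatives `embIter k` (centre convention) differ by at most `w·L^k` (induction on `k`; `(emb x)_μ = x_μ·L + (L−1)∕2`, standing range `k ≤ m + K`).
[cite: Balaban1987RG1, (0.1)–(0.3) pp.251–252 (bookkeeping)] -/
theorem abs_val_embIter_sub_le : ∀ {k : ℕ}, k ≤ P.m + P.K → ∀ (x x' : Site P k) (w : ℕ),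
    (∀ μ : Fin P.d, |((x μ).val : ℤ) - ((x' μ).val : ℤ)| ≤ w) →
      ∀ μ : Fin P.d, |((embIter k x μ).val : ℤ) - ((embIter k x' μ).val : ℤ)| ≤ (w * P.L ^ k : ℕ)
  | 0, _, x, x', w, h, μ => by simpa [embIter] using h μ
  | k + 1, hk, x, x', w, h, μ => by
    show |((embIter k (emb x) μ).val : ℤ) - ((embIter k (emb x') μ).val : ℤ)| ≤ ((w * P.L ^ (k + 1) : ℕ) : ℤ)
    have hk' : k ≤ P.m + P.K := by omega
    have hstep : ∀ ν : Fin P.d, |(((emb x) ν).val : ℤ) - (((emb x') ν).val : ℤ)| ≤ (w * P.L : ℕ) := by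
      intro ν
      rw [Site.val_emb hk x ν, Site.val_emb hk x' ν]
      have e : ((((x ν).val * P.L + (P.L - 1) / 2 : ℕ) : ℤ) - (((x' ν).val * P.L + (P.L - 1) / 2 : ℕ) : ℤ)) =
          (((x ν).val : ℤ) - ((x' ν).val : ℤ)) * (P.L : ℤ) := by push_cast; ring
      rw [e, abs_mul, Nat.abs_cast]
      push_cast
      exact mul_le_mul_of_nonneg_right (h ν) (by positivity)
    have ih := abs_val_embIter_sub_le hk' (emb x) (emb x') (w * P.L) hstep μ
    have e : w * P.L * P.L ^ k = w * P.L ^ (k + 1) := by ring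
    rwa [e] at ih

/-- **A LEVEL-`k` SITE AND THE CENTRE OF ITS BLOCK LAND WITHIN `L·L^k` FINE LABELS** under `embIter k` (dag-n11-d's `abs_val_emb_blockOf_sub_le` + the stretching lemma).
[cite: Balaban1987RG1, (0.1)–(0.3) pp.251–252 (bookkeeping)] -/
theorem abs_val_embIter_emb_blockOf_sub_le {k : ℕ} (hk : k + 1 ≤ P.m + P.K) (t : Site P k) (μ : Fin P.d) :
    |((embIter k t μ).val : ℤ) - ((embIter k (emb (blockOf t)) μ).val : ℤ)| ≤ (P.L * P.L ^ k : ℕ) := by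
  refine abs_val_embIter_sub_le (by omega) t (emb (blockOf t)) P.L (fun ν => ?_) μ
  rw [abs_sub_comm]
  exact abs_val_emb_blockOf_sub_le hk t ν

variable {F : T4Family} {ν : Stage7Numerics}

/-- **THE TWO NUMERIC SIDE CONDITIONS AT LEVEL `k` FROM `0 < M₂`**: the side of the χ_{k+1}-cubes is `L^{k+2}·M₂·R_{k+1}` fine sites, so `0 < side` and `L·L^k ≤ 2·side`.
[cite: Balaban1988Convergent, (3.2) p.265, (2.17) p.257, (2.5) p.255 (bookkeeping)] -/
theorem sideχ_level_guards (hM₂ : 0 < ν.M₂) (p : B12.RunParams) (g : ℕ → ℝ) (k : ℕ) :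
    0 < sideχ F ν p g k ∧ (F.P p.K).L * (F.P p.K).L ^ k ≤ 2 * sideχ F ν p g k := by
  have hL : 1 ≤ (F.P p.K).L := (F.P p.K).L_pos
  have hR : 1 ≤ RkOfRecord (F.P p.K).L ν.r (g (k + 1)) := B14SeparationOfRecord.one_le_RkOfRecord hL _ _
  have hMR : 1 ≤ ν.M₂ * RkOfRecord (F.P p.K).L ν.r (g (k + 1)) := Nat.one_le_iff_ne_zero.2 (Nat.mul_ne_zero (by omega) (by omega))
  have e : sideχ F ν p g k = (F.P p.K).L * (F.P p.K).L ^ k * (F.P p.K).L * (ν.M₂ * RkOfRecord (F.P p.K).L ν.r (g (k + 1))) := by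
    simp only [sideχ, cubeSide]; ring
  have hpos : 0 < (F.P p.K).L * (F.P p.K).L ^ k := Nat.mul_pos (by omega) (Nat.pow_pos (by omega))
  rw [e]
  constructor
  · exact Nat.mul_pos (Nat.mul_pos hpos (by omega)) (by omega)
  · calc (F.P p.K).L * (F.P p.K).L ^ k = (F.P p.K).L * (F.P p.K).L ^ k * 1 * 1 := by ring
      _ ≤ (F.P p.K).L * (F.P p.K).L ^ k * (F.P p.K).L * (ν.M₂ * RkOfRecord (F.P p.K).L ν.r (g (k + 1))) :=
          Nat.mul_le_mul (Nat.mul_le_mul_left _ hL) hMR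
      _ ≤ 2 * ((F.P p.K).L * (F.P p.K).L ^ k * (F.P p.K).L * (ν.M₂ * RkOfRecord (F.P p.K).L ν.r (g (k + 1)))) := Nat.le_mul_of_pos_left _ (by norm_num)

variable {N : ℕ} [NeZero N] {M : ℕ}

/-- ★ **A LEVEL-`k` BOND INSIDE A BLOCK IS READ BY THE (3.3) CUBE OF THE BLOCK's CENTRE, AT THE RECORD, AT EVERY STEP `k < K`.**  For the pinned (3.3)∕(3.4) data of record at step
`k+1` (starred bond sets `(□′^{∼2})^{(k)*}` = the level-`k` bonds whose two `embIter k`-representatives lie in `□′^{∼2}`), a bond with both ends in the block `B^k(y)`,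
`y ∈ T^{(k+1)}`, lies in the starred bond set of the `L²M₂R_{k+1}`-cube `□′` containing `embIter k (emb y)`: both ends land within `L·L^k` labels of that point, and `L·L^k ≤ 2·side`
puts them in `□′^{∼2}`.  Displayed numeric side conditions `0 < side`, `L·L^k ≤ 2·side` (both from `0 < M₂`, `sideχ_level_guards`).  E's `k = 0` lemma is the case `embIter 0 = id`.
[cite: Balaban1988Convergent, (3.3)–(3.4) p.265, (2.17) p.257; Balaban1987RG1, (0.1)–(0.3) pp.251–252] -/
theorem mem_bondsStar_sect3DataOfRecord_of_blockOf_eq_level (p : B12.RunParams) {k : ℕ} (hk : k < p.K) (g : ℕ → ℝ) (s : SeqOfRecord F ν M g p.K k)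
    (hside : 0 < sideχ F ν p g k) (hL : (F.P p.K).L * (F.P p.K).L ^ k ≤ 2 * sideχ F ν p g k) {y : Site (F.P p.K) (k + 1)} {b : PBond (F.P p.K) k}
    (hsrc : blockOf b.src = y) (htgt : blockOf b.tgt = y) :
    b ∈ (sect3DataOfRecord F N ν M p g k s).bondsStar
      ⟨cubeOfSite (sideχ F ν p g k) (embIter k (emb y)), cubeOfSite_mem_cubeIndices (sideχ F ν p g k) hside (embIter k (emb y))⟩ := by
  classical
  have hj : k + 1 ≤ (F.P p.K).m + (F.P p.K).K := by simp only [T4Family.P_K, T4Family.P_m]; omega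
  have hz : lift (F.P p.K) (embIter k (emb y)) ∈
      B14.Eq213MaximalDomains.cubeExt (sideχ F ν p g k) (cubeOfSite (sideχ F ν p g k) (embIter k (emb y))) ((0 * sideχ F ν p g k : ℕ) : ℤ) :=
    mem_cubeExt_cubeIdx_of_near (sideχ F ν p g k) hside _ _ (fun i => ⟨by simp, by simp⟩)
  have key : ∀ t : Site (F.P p.K) k, blockOf t = y →
      embIter k t ∈ cubeEnl (F.P p.K) (sideχ F ν p g k) (cubeOfSite (sideχ F ν p g k) (embIter k (emb y))) 2 := by
    intro t ht
    refine mem_cubeEnl_of_val_near_cover hz (w := (F.P p.K).L * (F.P p.K).L ^ k) (fun i => ?_) (by omega)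
    rw [cover_lift, ← ht]
    exact abs_val_embIter_emb_blockOf_sub_le hj t i
  simp only [sect3DataOfRecord]
  exact Finset.mem_filter.2 ⟨Finset.mem_univ _, key b.src hsrc, key b.tgt htgt⟩

/-- **HENCE EVERY BOND OF THE BLOCK-COMB FOREST OF `Y ⊆ T^{(k+1)}` IS READ BY THE CUBE OF ITS OWN BLOCK's CENTRE** (the row `hcb` of E §2 ∕ F §1 at level `k`, for the reading
map `b ↦ □′(embIter k (emb (B^k b₋)))`). [cite: Balaban1988Convergent, (3.3)–(3.4) p.265; Balaban1987RG1, (0.16) p.255 (bookkeeping)] -/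
theorem blockCombs_read_by_centre_cubes (p : B12.RunParams) {k : ℕ} (hk : k < p.K) [DecidableEq (PBond (F.P p.K) k)] (g : ℕ → ℝ)
    (s : SeqOfRecord F ν M g p.K k) (hside : 0 < sideχ F ν p g k) (hL : (F.P p.K).L * (F.P p.K).L ^ k ≤ 2 * sideχ F ν p g k)
    (Y : Finset (Site (F.P p.K) (k + 1))) :
    ∀ b ∈ Y.biUnion (fun y : Site (F.P p.K) (k + 1) =>
        (combBonds (fun κ => (((y κ).val * (F.P p.K).L : ℕ) : ℤ)) (fun κ => (((y κ).val * (F.P p.K).L + ((F.P p.K).L - 1) : ℕ) : ℤ)) : Finset (PBond (F.P p.K) k))),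
      b ∈ (sect3DataOfRecord F N ν M p g k s).bondsStar
        ⟨cubeOfSite (sideχ F ν p g k) (embIter k (emb (blockOf b.src))), cubeOfSite_mem_cubeIndices (sideχ F ν p g k) hside _⟩ := by
  have hj : k + 1 ≤ (F.P p.K).m + (F.P p.K).K := by simp only [T4Family.P_K, T4Family.P_m]; omega
  intro b hb
  obtain ⟨y, -, hby⟩ := Finset.mem_biUnion.1 hb
  obtain ⟨hsrc, htgt⟩ := blockOf_ends_of_mem_blockComb hj y hby
  exact mem_bondsStar_sect3DataOfRecord_of_blockOf_eq_level (N := N) p hk g s hside hL rfl (htgt.trans hsrc.symm)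

end Geometry

/-! ## §2  At the record, EVERY step `k < K`: E's transport bound, F's graph-mass bound and F's measure bound with one block comb per block of `Y ⊆ T^{(k+1)}` -/

section Level

variable (F : T4Family) (N : ℕ) [NeZero N] {ν : Stage7Numerics} {M : ℕ}

/-- The standing range `k + 1 ≤ m + K` of the `K`-th torus from `k < K` (bookkeeping). [folklore] -/
private theorem succ_le_m_add_K {K k : ℕ} (hk : k < K) : k + 1 ≤ (F.P K).m + (F.P K).K := by
  simp only [T4Family.P_K, T4Family.P_m]; omega

/-- ★★★ **E §2 AT EVERY STEP WITH THE BLOCK-COMB FOREST: UNDER (†) THE ALL-SMALL-FIELD TERM OF STEP `k+1` IS AT MOST `C·Haar{|h − 1| < 2δ}^{|Y|·(L^d − 1)}` TIMES THE TRANSPORT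
OF THE OLD DENSITY, A.E.**  For `k < K`, the pinned (3.3)∕(3.4) data of record of any length-`k` history `s`, any threshold `2δ`, any cube set `X`, a weight `χ′_k(X)·w̃` with `w̃`
jointly measurable and `|w̃| ≤ C`, `ρ ≥ 0` measurable integrable fine-gauge invariant, and any `Y ⊆ T^{(k+1)}` whose blocks' centre cubes lie in `X` (row `hY`):
`|transportOfRecord k (χ′_k(X)(·,V′)·w̃(·,V′)·ρ) V′| ≤ C·Haar{|h − 1| < 2δ}^{|Y|·(L^d − 1)} · transportOfRecord k ρ V′` for `dV′`-a.e. `V′` (cube side conditions displayed).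
[cite: Balaban1988Convergent, (3.1) p.264, (3.3)–(3.4) p.265 with L.8–12, (3.25) p.270; Balaban1987RG1, (0.13)–(0.16) pp.254–255] -/
theorem abs_transportOfRecord_chiPrime_mul_le_ae_blockCombs_level (p : B12.RunParams) {k : ℕ} (hk : k < p.K) [DecidableEq (PBond (F.P p.K) k)]
    {ρ : Density (F.P p.K) k (SU N)} (hρ : FineGaugeInvariant ρ) (hρm : Measurable ρ) (hρi : Integrable ρ (fieldMeasure (F.P p.K) k (SU N)))
    (hρ0 : ∀ U, 0 ≤ ρ U) (g : ℕ → ℝ) (s : SeqOfRecord F ν M g p.K k) (twoδ : ℝ) (X : Finset (Iχ F ν p g k))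
    (hside : 0 < sideχ F ν p g k) (hL : (F.P p.K).L * (F.P p.K).L ^ k ≤ 2 * sideχ F ν p g k) (Y : Finset (Site (F.P p.K) (k + 1)))
    (hY : ∀ y ∈ Y, (⟨cubeOfSite (sideχ F ν p g k) (embIter k (emb y)), cubeOfSite_mem_cubeIndices (sideχ F ν p g k) hside _⟩ : Iχ F ν p g k) ∈ X)
    {w : GaugeField (F.P p.K) k (SU N) → GaugeField (F.P p.K) (k + 1) (SU N) → ℝ}
    (hm : Measurable fun q : GaugeField (F.P p.K) k (SU N) × GaugeField (F.P p.K) (k + 1) (SU N) =>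
      chiPrime (sect3DataOfRecord F N ν M p g k s) (avOfRecord F N p.K) twoδ X q.1 q.2 * w q.1 q.2)
    {C : ℝ} (hw : ∀ U V, |w U V| ≤ C) :
    ∀ᵐ V' ∂fieldMeasure (F.P p.K) (k + 1) (SU N),
      |transportOfRecord F N p.K k (fun U => chiPrime (sect3DataOfRecord F N ν M p g k s) (avOfRecord F N p.K) twoδ X U V' * w U V' * ρ U) V'| ≤
        C * ((HaarData.haar : Measure (SU N)) {h : SU N | dist1 h < twoδ}).toReal ^ (Y.card * ((F.P p.K).L ^ (F.P p.K).d - 1)) * transportOfRecord F N p.K k ρ V' := by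
  have hj : k + 1 ≤ (F.P p.K).m + (F.P p.K).K := succ_le_m_add_K F hk
  obtain ⟨v, r, hT, hv⟩ := exists_treeOrder_blockCombs_avoiding_emb hj Y
  rw [← card_blockCombs (P := F.P p.K) (j := k) hj Y]
  refine abs_transportOfRecord_chiPrime_mul_le_ae F N hk hρ hρm hρi hρ0 (sect3DataOfRecord F N ν M p g k s) (avOfRecord F N p.K) twoδ X hT hv
    (fun b => ⟨cubeOfSite (sideχ F ν p g k) (embIter k (emb (blockOf b.src))), cubeOfSite_mem_cubeIndices (sideχ F ν p g k) hside _⟩) (fun b hb => ?_)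
    (blockCombs_read_by_centre_cubes p hk g s hside hL Y) hm hw
  obtain ⟨y, hy, hby⟩ := Finset.mem_biUnion.1 hb
  obtain ⟨hsrc, -⟩ := blockOf_ends_of_mem_blockComb hj y hby
  rw [hsrc]
  exact hY y hy

/-- ★★★ **F §1 AT EVERY STEP WITH THE BLOCK-COMB FOREST: ON THE GRAPH THE ALL-SMALL WEIGHT OF STEP `k+1` PAIRS TO AT MOST `C·Haar{|h − 1| < 2δ}^{|Y|·(L^d − 1)}` TIMES THE MASS
OF THE DENSITY**: `|∫dU χ′_k(X)(U,ŪU)·w̃(U,ŪU)·ρ(U)| ≤ C·Haar{|h − 1| < 2δ}^{|Y|·(L^d − 1)}·∫dU ρ` (same data and rows as the previous theorem).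
[cite: Balaban1988Convergent, (3.1) p.264, (3.3)–(3.4) p.265 with L.8–12, (3.16) p.268; Balaban1987RG1, (0.13)–(0.16) pp.254–255] -/
theorem abs_integral_chiPrime_mul_graph_le_blockCombs_level (p : B12.RunParams) {k : ℕ} (hk : k < p.K) [DecidableEq (PBond (F.P p.K) k)]
    {ρ : Density (F.P p.K) k (SU N)} (hρ : FineGaugeInvariant ρ) (hρi : Integrable ρ (fieldMeasure (F.P p.K) k (SU N))) (hρ0 : ∀ U, 0 ≤ ρ U)
    (g : ℕ → ℝ) (s : SeqOfRecord F ν M g p.K k) (twoδ : ℝ) (X : Finset (Iχ F ν p g k))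
    (hside : 0 < sideχ F ν p g k) (hL : (F.P p.K).L * (F.P p.K).L ^ k ≤ 2 * sideχ F ν p g k) (Y : Finset (Site (F.P p.K) (k + 1)))
    (hY : ∀ y ∈ Y, (⟨cubeOfSite (sideχ F ν p g k) (embIter k (emb y)), cubeOfSite_mem_cubeIndices (sideχ F ν p g k) hside _⟩ : Iχ F ν p g k) ∈ X)
    {w : GaugeField (F.P p.K) k (SU N) → GaugeField (F.P p.K) (k + 1) (SU N) → ℝ}
    (hm : Measurable fun q : GaugeField (F.P p.K) k (SU N) × GaugeField (F.P p.K) (k + 1) (SU N) =>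
      chiPrime (sect3DataOfRecord F N ν M p g k s) (avOfRecord F N p.K) twoδ X q.1 q.2 * w q.1 q.2)
    {C : ℝ} (hw : ∀ U V, |w U V| ≤ C) :
    |∫ U, chiPrime (sect3DataOfRecord F N ν M p g k s) (avOfRecord F N p.K) twoδ X U ((avOfRecord F N p.K k).avg U) *
        w U ((avOfRecord F N p.K k).avg U) * ρ U ∂fieldMeasure (F.P p.K) k (SU N)| ≤
      C * ((HaarData.haar : Measure (SU N)) {h : SU N | dist1 h < twoδ}).toReal ^ (Y.card * ((F.P p.K).L ^ (F.P p.K).d - 1)) *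
        ∫ U, ρ U ∂fieldMeasure (F.P p.K) k (SU N) := by
  have hj : k + 1 ≤ (F.P p.K).m + (F.P p.K).K := succ_le_m_add_K F hk
  obtain ⟨v, r, hT, hv⟩ := exists_treeOrder_blockCombs_avoiding_emb hj Y
  rw [← card_blockCombs (P := F.P p.K) (j := k) hj Y]
  refine abs_integral_chiPrime_mul_graph_le hj (avOfRecord_measurable F N p.K k) (fun _ hu U => avOfRecord_gaugeAct_of_fineGauge F N hk hu U) hρ hρi hρ0
    (sect3DataOfRecord F N ν M p g k s) (avOfRecord F N p.K) twoδ X hT hv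
    (fun b => ⟨cubeOfSite (sideχ F ν p g k) (embIter k (emb (blockOf b.src))), cubeOfSite_mem_cubeIndices (sideχ F ν p g k) hside _⟩) (fun b hb => ?_)
    (blockCombs_read_by_centre_cubes p hk g s hside hL Y) hm hw
  obtain ⟨y, hy, hby⟩ := Finset.mem_biUnion.1 hb
  obtain ⟨hsrc, -⟩ := blockOf_ends_of_mem_blockComb hj y hby
  rw [hsrc]
  exact hY y hy

/-- ★★★ **F's MEASURE BOUND AT EVERY STEP: THE (3.3)-ALL-SMALL CLASS OF STEP `k+1` ON THE GRAPH HAS `dU`-MEASURE AT MOST `Haar{|h − 1| < 2δ}^{|Y|·(L^d − 1)}`** — for `k < K`,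
any length-`k` history `s`, any threshold, any cube set `X` and any `Y ⊆ T^{(k+1)}` whose blocks' centre cubes lie in `X`:
`dU{U | every □′ ∈ X is (3.3)-small at (U, ŪU)} ≤ Haar{|h − 1| < 2δ}^{|Y|·(L^d − 1)}` (cube side conditions displayed; NO lower bound claimed).
[cite: Balaban1988Convergent, (3.2)–(3.4) p.265 with L.8–12, (2.16) p.257; Balaban1987RG1, (0.13)–(0.16) pp.254–255] -/
theorem measure_allSmall33_graph_le_pow_blockCombs_level (p : B12.RunParams) {k : ℕ} (hk : k < p.K) [DecidableEq (PBond (F.P p.K) k)] (g : ℕ → ℝ)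
    (s : SeqOfRecord F ν M g p.K k) (twoδ : ℝ) (X : Finset (Iχ F ν p g k))
    (hside : 0 < sideχ F ν p g k) (hL : (F.P p.K).L * (F.P p.K).L ^ k ≤ 2 * sideχ F ν p g k) (Y : Finset (Site (F.P p.K) (k + 1)))
    (hY : ∀ y ∈ Y, (⟨cubeOfSite (sideχ F ν p g k) (embIter k (emb y)), cubeOfSite_mem_cubeIndices (sideχ F ν p g k) hside _⟩ : Iχ F ν p g k) ∈ X) :
    fieldMeasure (F.P p.K) k (SU N) {U : GaugeField (F.P p.K) k (SU N) |
        ∀ c ∈ X, SmallApproxFluct (sect3DataOfRecord F N ν M p g k s) (avOfRecord F N p.K) twoδ U ((avOfRecord F N p.K k).avg U) c} ≤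
      ((HaarData.haar : Measure (SU N)) {h : SU N | dist1 h < twoδ}) ^ (Y.card * ((F.P p.K).L ^ (F.P p.K).d - 1)) := by
  have hj : k + 1 ≤ (F.P p.K).m + (F.P p.K).K := succ_le_m_add_K F hk
  obtain ⟨v, r, hT, hv⟩ := exists_treeOrder_blockCombs_avoiding_emb hj Y
  rw [← card_blockCombs (P := F.P p.K) (j := k) hj Y]
  refine measure_smallApproxFluct_graph_le_pow hj (avOfRecord_measurable F N p.K k) (fun _ hu U => avOfRecord_gaugeAct_of_fineGauge F N hk hu U)
    (sect3DataOfRecord F N ν M p g k s) (avOfRecord F N p.K) twoδ X hT hv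
    (fun b => ⟨cubeOfSite (sideχ F ν p g k) (embIter k (emb (blockOf b.src))), cubeOfSite_mem_cubeIndices (sideχ F ν p g k) hside _⟩) (fun b hb => ?_)
    (blockCombs_read_by_centre_cubes p hk g s hside hL Y) (measurable_chiPrime_sect3DataOfRecord F N p g k s twoδ X)
  obtain ⟨y, hy, hby⟩ := Finset.mem_biUnion.1 hb
  obtain ⟨hsrc, -⟩ := blockOf_ends_of_mem_blockComb hj y hby
  rw [hsrc]
  exact hY y hy

/-- ★★★ **THE SAME FOR ALL CUBES (`X = univ`) UNDER THE NUMERICS ROW `0 < M₂` ONLY**: at every step `k < K`, for every `Y ⊆ T^{(k+1)}`,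
`dU{U | every L²M₂R_{k+1}-cube is (3.3)-small at (U, ŪU)} ≤ Haar{|h − 1| < 2δ}^{|Y|·(L^d − 1)}`. [cite: Balaban1988Convergent, (3.2)–(3.4) p.265, (2.17) p.257, (2.5) p.255] -/
theorem measure_allSmall33_graph_le_pow_blockCombs_level_of_M₂_pos (hM₂ : 0 < ν.M₂) (p : B12.RunParams) {k : ℕ} (hk : k < p.K) [DecidableEq (PBond (F.P p.K) k)]
    (g : ℕ → ℝ) (s : SeqOfRecord F ν M g p.K k) (twoδ : ℝ) (Y : Finset (Site (F.P p.K) (k + 1))) :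
    fieldMeasure (F.P p.K) k (SU N) {U : GaugeField (F.P p.K) k (SU N) |
        ∀ c : Iχ F ν p g k, SmallApproxFluct (sect3DataOfRecord F N ν M p g k s) (avOfRecord F N p.K) twoδ U ((avOfRecord F N p.K k).avg U) c} ≤
      ((HaarData.haar : Measure (SU N)) {h : SU N | dist1 h < twoδ}) ^ (Y.card * ((F.P p.K).L ^ (F.P p.K).d - 1)) := by
  obtain ⟨hside, hL⟩ := sideχ_level_guards (F := F) hM₂ p g k
  have e : {U : GaugeField (F.P p.K) k (SU N) |
      ∀ c : Iχ F ν p g k, SmallApproxFluct (sect3DataOfRecord F N ν M p g k s) (avOfRecord F N p.K) twoδ U ((avOfRecord F N p.K k).avg U) c} =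
      {U | ∀ c ∈ (Finset.univ : Finset (Iχ F ν p g k)),
        SmallApproxFluct (sect3DataOfRecord F N ν M p g k s) (avOfRecord F N p.K) twoδ U ((avOfRecord F N p.K k).avg U) c} := by
    ext U; simp only [Set.mem_setOf_eq, Finset.mem_univ, forall_true_left]
  rw [e]
  exact measure_allSmall33_graph_le_pow_blockCombs_level F N p hk g s twoδ Finset.univ hside hL Y (fun _ _ => Finset.mem_univ _)

/-- ★★ **AT `N = 2`, EVERY STEP `k < K`, `0 ≤ 2δ ≤ 1`, `0 < M₂`: `dU{U | every cube (3.3)-small at (U, ŪU)} ≤ (π²(2δ)³∕12)^{|Y|·(L^d − 1)}`** (dag-n08-w3's SU(2) ball volume BY NAME).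
[cite: Balaban1988Convergent, (3.3)–(3.4) p.265; Balaban1985UV3, p.260 (bookkeeping)] -/
theorem measure_allSmall33_graph_le_pow_blockCombs_level_su2 {F : T4Family} {ν : Stage7Numerics} {M : ℕ} (hM₂ : 0 < ν.M₂) (p : B12.RunParams) {k : ℕ}
    (hk : k < p.K) [DecidableEq (PBond (F.P p.K) k)] (g : ℕ → ℝ) (s : SeqOfRecord F ν M g p.K k) {twoδ : ℝ} (h0 : 0 ≤ twoδ) (h1 : twoδ ≤ 1)
    (Y : Finset (Site (F.P p.K) (k + 1))) :
    fieldMeasure (F.P p.K) k (SU 2) {U : GaugeField (F.P p.K) k (SU 2) |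
        ∀ c : Iχ F ν p g k, SmallApproxFluct (sect3DataOfRecord F 2 ν M p g k s) (avOfRecord F 2 p.K) twoδ U ((avOfRecord F 2 p.K k).avg U) c} ≤
      ENNReal.ofReal ((Real.pi ^ 2 * twoδ ^ 3 / 12) ^ (Y.card * ((F.P p.K).L ^ (F.P p.K).d - 1))) := by
  refine (measure_allSmall33_graph_le_pow_blockCombs_level_of_M₂_pos F 2 hM₂ p hk g s twoδ Y).trans ?_
  have hfin : (HaarData.haar : Measure (SU 2)) {h : SU 2 | dist1 h < twoδ} ≠ ∞ := measure_ne_top _ _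
  rw [← ENNReal.ofReal_toReal hfin, ← ENNReal.ofReal_pow ENNReal.toReal_nonneg]
  exact ENNReal.ofReal_le_ofReal (pow_le_pow_left₀ ENNReal.toReal_nonneg (toReal_haar_dist1_lt_le_su2 h0 h1) _)

end Level

/-! ## §3  The first step in dag-n11-d's phrasing: `{U | χ′_0(ALL)(U, ŪU) ≠ 0}` -/

section FirstStep

variable {F : T4Family} {N : ℕ} [NeZero N] {ν : Stage7Numerics} {M : ℕ}

/-- ★★ **`dU{U | χ′_0(ALL)(U, ŪU) ≠ 0} ≤ Haar{|h − 1| < 2δ}^{|Y|·(L^d − 1)}` FOR EVERY `Y ⊆ T^{(1)}`** — F §3's first-step bound on the set exactly as dag-n11-d's graph reading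
(`…TopPairStepWeightDeadOnGraph`) phrases the (3.3)-half of its all-small class (`χ′` is `0∕1`-valued, so `χ′ ≠ 0 ↔ every cube is (3.3)-small`); their class also asks every
χ₁-cube to be (3.2)-small at `ŪU`, a subset. Cube side conditions displayed (`0 < side`, `L ≤ 2·side`; both from `0 < M₂` at `k = 0`, or from their guard `3·LM₁ ≤ side`).
[cite: Balaban1988Convergent, (3.2)–(3.4) p.265 with L.8–12; Balaban1987RG1, (0.13)–(0.16) pp.254–255] -/
theorem measure_chiPrime_graph_ne_zero_le_pow_blockCombs (p : B12.RunParams) (hK : 0 < p.K) [DecidableEq (PBond (F.P p.K) 0)] (g : ℕ → ℝ)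
    (s : SeqOfRecord F ν M g p.K 0) (twoδ : ℝ) (hside : 0 < sideχ F ν p g 0) (hL : (F.P p.K).L ≤ 2 * sideχ F ν p g 0) (Y : Finset (Site (F.P p.K) 1)) :
    fieldMeasure (F.P p.K) 0 (SU N) {U : GaugeField (F.P p.K) 0 (SU N) |
        chiPrime (sect3DataOfRecord F N ν M p g 0 s) (avOfRecord F N p.K) twoδ (Finset.univ : Finset (Iχ F ν p g 0)) U ((avOfRecord F N p.K 0).avg U) ≠ 0} ≤
      ((HaarData.haar : Measure (SU N)) {h : SU N | dist1 h < twoδ}) ^ (Y.card * ((F.P p.K).L ^ (F.P p.K).d - 1)) := by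
  classical
  have e : {U : GaugeField (F.P p.K) 0 (SU N) |
      chiPrime (sect3DataOfRecord F N ν M p g 0 s) (avOfRecord F N p.K) twoδ (Finset.univ : Finset (Iχ F ν p g 0)) U ((avOfRecord F N p.K 0).avg U) ≠ 0} =
      {U : GaugeField (F.P p.K) 0 (SU N) |
        ∀ c : Iχ F ν p g 0, SmallApproxFluct (sect3DataOfRecord F N ν M p g 0 s) (avOfRecord F N p.K) twoδ U ((avOfRecord F N p.K 0).avg U) c} := by
    ext U
    simp only [Set.mem_setOf_eq]
    constructor
    · intro hne c
      by_contra hc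
      apply hne
      unfold chiPrime
      exact Finset.prod_eq_zero (Finset.mem_univ c) (if_neg hc)
    · intro hall
      rw [(chiPrime_eq_one_iff (sect3DataOfRecord F N ν M p g 0 s) (avOfRecord F N p.K) twoδ (Finset.univ : Finset (Iχ F ν p g 0)) U
        ((avOfRecord F N p.K 0).avg U)).2 fun c _ => hall c]
      exact one_ne_zero
  rw [e]
  exact measure_allSmall33_graph_le_pow_blockCombs p hK g s twoδ hside hL Y

end FirstStep

end Summit.QuantumFields.YangMills.Theorems.BalabanUVNodesN11ChiPrimeAllSmallClassMeasureLevel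

end
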